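import Literature.MathematicalPhysics.QuantumFieldTheory.Balaban1983to89.B1Ineq337HiggsModel
import Literature.MathematicalPhysics.QuantumFieldTheory.Balaban1983to89.HiggsActionIntegrable
import Literature.MathematicalPhysics.QuantumFieldTheory.Balaban1983to89.B1IndHyp326Proof
import Literature.MathematicalPhysics.QuantumFieldTheory.Balaban1983to89.B1Ineq367Proof

/-!
# `Balaban1983to89.B1Ineq326HiggsModel` — T. Bałaban, *(Higgs)₂,₃ quantum fields in a finite volume. I. A lower bound*,
Commun. Math. Phys. **85** (1982) 603–626 [Balaban1982Higgs1]: **the induction of Sect. 3 closing the fundamental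
inequality (3.26) p. 617, FOR THE (Higgs)₂,₃ MODEL ON ONE CARRIER** — the run of the model (its cut-off integrals
`∫dA∫dφ χ_k(A)χ_k(φ)exp(−S^{(k),L^kε}(A,φ))` with the PRINTED characteristic functions (3.1)–(3.2)/(3.27)–(3.28), `Z^ε`,
`|T_ε|`), the ONE-STEP INEQUALITY between two consecutive cut-off integrals PROVED from (2.9)/(3.37) for the model's double
renormalization transformation and the printed lower bound of the inner integral ((3.38), (3.51), (3.55), (3.60) read back on
the `L^{k+1}ε`-lattice, p. 623 — displayed as the hypothesis: it is the content of Props. 3.1, 3.2 and of the cluster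
expansion (3.59), proved in [III]), hence (3.26) for every `k ≦ K` for the model and r14's `B1LowerBound.IndHyp326` for a
family of lattice spacings; plus (3.26)_K ⇒ (3.67) p. 625 for the model

statement-level skeleton of published theorems with citation tags; proofs where landed; nothing here is a claim about the Yang–Mills mass gap

PDF held: `paper:balaban1982-cmp85-higgs23-i` (journal page = PDF page + 602); pp. 613, 617, 618, 622, 623, 625 READ AS IMAGES
on the ×2 renders `run/shared/lean/pub/pub-balaban/b2b-balaban-ref1/pages/1982-cmp85-higgs23-I/…-p0{11,15,16,20,21,23}-x2.png`.

CITATION HEADER (lean-in-tree rule).  lit-balaban typed skeleton (HOME `run/shared/lean/pub/lit-balaban/`), SKELETON row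
**B1.Eq3.26** (owners r01/r12/r14; decl of record `B1LowerBound.IndHyp326` over the run carrier `B1LowerBound.Run326`,
typed p239114; induction-on-`k` closing proved schematically `B1IndHyp326Proof.indHyp326_of_step`, p247123; base `k = 0`
for the model `B1Ineq36Printed.base326_printed`, p248030; (3.37) for the model `B1Ineq337HiggsModel.lowerStep337`, p247729).
THIS FILE is the MODEL INSTANCE of the whole induction: the run carrier INHABITED by the model's own integrals, the step
hypothesis of `indHyp326_of_step` REDUCED, for the model's concrete transformations and characteristic functions, to the
printed pointwise lower bound of the inner integral of (3.37).
WHAT IS REPRODUCED, verbatim.  p. 617 [PDF 15]: *"We assume that after k renormalization transformations we get an action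
S^{(k),L^kε}(A,φ) for the fields A, φ on L^kε-lattice T^{(k)}_{L^kε}. For this action the following fundamental inequality
holds Z^ε ≧ ∫dA∫dφ χ_k(A)χ_k(φ) exp(−S^{(k),L^kε}(A,φ) + Σ_{j=0}^{k−1} O(1)(L^jε)^{κ₀}|T_ε|), (3.26) … Of course in O(1) in
(3.26) is independent of k, and κ₀ > 0."*; p. 618 [PDF 16]: *"From (3.26) and (2.9) we have Z^ε ≧ ∫dB∫dψ χ_{k+1}(B)χ_{k+1}(ψ)
T^{L^kε}_{a,L}[T^{L^kε}_{a,L,A^{(k),ε}}[χ_k(A)χ_k(φ)·exp(−S^{(k),L^kε}(A,φ))]] exp(Σ_{j=0}^{k−1} O(1)(L^jε)^{κ₀}|T_ε|) (3.37) and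
we have to calculate the internal integral above."*; p. 622 [PDF 20]: *"(the right side of (3.51)) ≧ const Z_kZ_k(B^{(k+1)})
·exp(−½⟨B,Δ^{(k+1),L}B⟩ − ½⟨ψ,Δ^{(k+1),L}(B^{(k+1)})ψ⟩)·(∫dA′exp(−½⟨A′,(C^{(k)})⁻¹A′⟩))(∫dφ′exp(−½⟨φ′,(C^{(k)}(B^{(k+1)}))⁻¹φ′⟩))
·χ_{k+1}(B)χ_{k+1}(ψ)∫dμ_{C^{(k)}}(A′)∫dμ_{C^{(k)}(B^{(k+1)})}(φ′)χ(A′)χ(φ′)·exp(V^{(k)} − E₀ + O(1)(L^kε)^κ|T₁^{(k)}|). (3.55)"*;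
p. 623 [PDF 21]: *"(3.56) ≧ exp(𝒫^{(k+1),L}(B^{(k+1)},ψ) + O(1)(L^kε)^κ|T₁^{(k)}|). (3.60)  The last operation is a rescaling
of the expression we got from the L-lattice for the fields B, ψ to the L^{k+1}ε-lattice T^{(k+1)}_{L^{k+1}ε}. Taking into
account the expressions and the inequalities (3.38), (3.51), (3.55), and (3.60), we get the inequalities and the expressions
of the induction hypothesis (3.26)–(3.32) but with k+1 instead of k."*; p. 613 [PDF 11]: *"Z^ε ≧ ∫dB∫dψ χ₁(B)χ₁(ψ)
T^ε_{a,L}[T^ε_{a,L,A}[χ₀(A)χ₀(φ)exp(−S^ε)]]. (3.6)"*.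

DICTIONARY (everything by name from the tree; nothing re-declared).  Fields of level `k` (the `L^kε`-lattice `T^{(k)}_{L^kε}`):
`HiggsLattice.VecField P k`, `ScalarField P k N`; `Z^ε` = `HiggsLattice.partitionFn P 0 N C c` (1.10), `S^ε` =
`HiggsLattice.action C c` (1.11); `|T_ε| = Σ_{x∈T_ε} ε^d` (1.21) = `P.vol 0 univ`; `L^kε` = `P.mesh k`.  `χ_k(A)χ_k(φ)` =
`B1Eq31Concrete.chiKA·chiKφ` (3.27)–(3.28) for `k ≧ 1`, `χ₀(A)χ₀(φ)` = `B1Eq31Concrete.chi0A·chi0φ` (3.1)–(3.2) at `k = 0`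
(the tree sets `a₀ = 0`, so (3.27) at `k = 0` is READ as (3.1), `A^{(0),ε} = A`) — `chiW`, thresholds `(ℓ_k, p_k)` per level
(printed `ℓ_k = L^kε`, `p_k = p(L^kε)`).  `T^{L^kε}_{a,L}[T^{L^kε}_{a,L,Ã_k(A)}[ρ]]` = `HiggsDoubleRT.doubleRTk C a Ã_k ρ` with
`Ã₀(A) = A` ((3.6): `T^ε_{a,L,A}`; `B1Ineq36HiggsModel.doubleRT_eq_doubleRTk`) and `Ã_k(A) = A^{(k),ε}` = `B1Eq31Concrete.bgVec`
(3.29) for `k ≧ 1` ((3.37)) — `extW`.  Actions `S^{(k),L^kε} = S k`, `k ≦ K`: ANY real functions of the level-`k` fields with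
`exp(−S k) ∈ L¹` (the form (3.30) is not used by the induction; `S 0 = S^ε` in the printed instance).  The run: r14's
`Run326` with `intK k = ∫dA∫dφ χ_kχ_k exp(−S k)`, `Z = ∫dA∫dφ exp(−S 0)`, `vol = |T_ε|`, `eps = ε`, `L = L` — `run326`.
THE STEP HYPOTHESIS `h360` (the printed analytic input, displayed): on the support of `χ_{k+1}(B)χ_{k+1}(ψ)`,
`exp(−S^{(k+1),L^{k+1}ε}(B,ψ))·exp(−C(L^kε)^{κ₀}|T_ε|) ≦ T^{L^kε}_{a,L}[T^{L^kε}_{a,L,Ã_k}[χ_kχ_k exp(−S^{(k),L^kε})]](B,ψ)` —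
(3.38) = (3.51) ≧ (3.55), (3.56) ≧ (3.60), the `(k+1)`-st action assembled as in (3.30) from the factors of (3.55) and
`𝒫^{(k+1),L}`, the error `O(1)(L^kε)^κ|T₁^{(k)}| = O(1)(L^kε)^{κ−d}|T_ε|` (`κ₀ = κ − d > 0`, `B1Ineq325Proof`), after *"rescaling
of the expression we got from the L-lattice … to the L^{k+1}ε-lattice"* (p. 623); its proof is Props. 3.1/3.2 and the lemma
of [2] = (3.59), i.e. [Balaban1983Higgs3].

WHAT THIS FILE PROVES (0 `sorry`; standard axioms).  §1 `chiW`, `extW`, `chiW_mem_Icc`, `measurable_chiW`, `measurable_extW`,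
`integrable_density`; §2 `run326` — THE RUN OF THE MODEL inhabiting r14's carrier, `run326_scale`, `run326_Z_printed` (`Z = Z^ε`
when `S 0 = S^ε`); §3 `base326_model` — (3.26) at `k = 0`; §4 **`lowerStep_model`** — the integral inequality of (3.6)/(3.37)
at EVERY level for the weights `chiW`: `∫dB∫dψ χ_{k+1}χ_{k+1}·T[T[χ_kχ_k e^{−S_k}]] ≦ ∫dA∫dφ χ_kχ_k e^{−S_k}`
(`HiggsDoubleRT.integral_cutoff_doubleRTk_le`); **`step326_model`** — THE ONE-STEP INEQUALITY `intK(k+1)·exp(−C(L^kε)^{κ₀}|T_ε|)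
≦ intK k` from `h360` at level `k`; §5 **`ineq326_model`** — **(3.26) FOR THE MODEL for every `k ≦ K`** from `h360` at the
levels `k < K` (`B1IndHyp326Proof.ineq326_of_step`); `ineq326_model_printed` — right side `Z^ε = partitionFn` (`S 0 = S^ε`,
`μ₀² > 0`, `λ > 0`); **`indHyp326_model`** — `B1LowerBound.IndHyp326` for a FAMILY of lattice data with ONE pair `(C, κ₀)`;
§6 `ineq367_model` — (3.26)_K ⇒ (3.67) p. 625 for the model: `B1Ineq367Proof.ineq367_O1` on the concrete level-`K`
configuration space, its `h326` DISCHARGED (the expansion inputs (E1)–(E3) of that file stay displayed).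
HONEST SCOPE.  (i) `h360` is NOT proved here (nor anywhere in the tree): it is the lower bound produced by pp. 619–623 and
[III].  (ii) The induction does not use the form (3.30), so `S k` is a parameter; identifying `S (k+1)` with the rescaled
`½⟨B,Δ^{(k+1)}B⟩ + ½⟨ψ,Δ^{(k+1)}(B^{(k+1)})ψ⟩ − 𝒫^{(k+1)} − log Z_{k+1} − log Z_{k+1}(B^{(k+1)}) + E₀` is part of READING `h360`.
(iii) The unit-lattice excursion (3.38) (`B1Eq338Rescaling`/`B1Eq338Display`/`B1Eq222Rescaling`/`B1Eq338Bridge`) is an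
IDENTITY; the hypothesis is stated after the rescaling back, where p. 623 places the conclusion.  (iv) No convergence beyond
`exp(−S k) ∈ L¹` is used.  Unit `lit-balaban-p14` gen 7 (Phase-2 proof seat p14, literature-prover-lit-balaban-p14-g7-0),
HOME `run/shared/lean/pub/lit-balaban/` (seat log `lit-balaban-p14/STATUS.md`).
-/

open scoped BigOperators
open _root_.MeasureTheory

namespace Literature.MathematicalPhysics.QuantumFieldTheory.Balaban1983to89.B1Ineq326HiggsModel

open Literature.MathematicalPhysics.QuantumFieldTheory.Balaban1983to89
open Literature.MathematicalPhysics.QuantumFieldTheory.Balaban1983to89.HiggsLattice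
open Literature.MathematicalPhysics.QuantumFieldTheory.Balaban1983to89.HiggsDoubleRT
open Literature.MathematicalPhysics.QuantumFieldTheory.Balaban1983to89.B1Eq31Concrete
  (bgVec chi0A chi0φ chiKA chiKφ chi0_mem_Icc chiK_mem_Icc measurable_chi0)
open Literature.MathematicalPhysics.QuantumFieldTheory.Balaban1983to89.HiggsCovarianceCont (measurable_chiK)
open Literature.MathematicalPhysics.QuantumFieldTheory.Balaban1983to89.HiggsActionIntegrable
  (integrable_exp_neg_action partitionFn_eq)
open Literature.MathematicalPhysics.QuantumFieldTheory.Balaban1983to89.B1Ineq337HiggsModel (aSeq_nonneg measurable_bgVec)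
open Literature.MathematicalPhysics.QuantumFieldTheory.Balaban1983to89.B1LowerBound (Run326 IndHyp326)
open Literature.MathematicalPhysics.QuantumFieldTheory.Balaban1983to89.B1IndHyp326Proof (ineq326_of_step indHyp326_of_step)
open Finset (range)

variable {P : Params} {N : ℕ}

/-! ## 1. The characteristic functions and the external fields of the successive steps -/

section Weights

/-- **The cut-off weight of the `k`-th step, `χ_k(A)χ_k(φ)`**: at `k = 0` the printed (3.1)–(3.2) p. 613 `χ₀(A)χ₀(φ)`
(`B1Eq31Concrete.chi0A·chi0φ`, the restriction of `A`, `φ` themselves = (3.27)–(3.28) read with `A^{(0),ε} = A`), for `k ≧ 1`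
the printed (3.27)–(3.28) p. 617 `χ_k(A)χ_k(φ)` (`B1Eq31Concrete.chiKA·chiKφ`, the restriction of the background fields (3.29));
thresholds `(ℓ_k, p_k)` per level (printed `ℓ_k = L^kε`, `p_k = p(L^kε) = B2.pFn b₀ p (L^kε)`), masses `μ₀²`, `m²`, parameter `a`.
[cite: Balaban1982Higgs1, (3.27)–(3.28) p.617; (3.1)–(3.2) p.613] -/
noncomputable def chiW (C : ChargeData N) (ℓ p : ℕ → ℝ) (mu0sq msq a : ℝ) :
    (k : ℕ) → VecField P k → ScalarField P k N → ℝ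
  | 0, A, φ => chi0A (ℓ 0) (p 0) A * chi0φ C (ℓ 0) (p 0) A φ
  | k + 1, A, φ => chiKA (ℓ (k + 1)) (p (k + 1)) mu0sq a (k + 1) A
      * chiKφ C (ℓ (k + 1)) (p (k + 1)) mu0sq msq a (k + 1) A φ

/-- **The external field of the `(k+1)`-st double transformation `T^{L^kε}_{a,L}[T^{L^kε}_{a,L,Ã_k(A)}[·]]`**: at the first
step `Ã₀(A) = A` ((3.6) p. 613: `T^ε_{a,L,A}`), afterwards `Ã_k(A) = A^{(k),ε} = a_k(L^kε)^{−2}G^ε_kQ^*_kA` ((3.37) p. 618 with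
(3.29): `B1Eq31Concrete.bgVec`). [cite: Balaban1982Higgs1, (3.37) p.618; (3.6) p.613] -/
noncomputable def extW (mu0sq a : ℝ) : (k : ℕ) → VecField P k → VecField P 0
  | 0, A => A
  | k + 1, A => bgVec mu0sq a (k + 1) A

/-- `0 ≦ χ_k(A)χ_k(φ) ≦ 1` at every level. [cite: Balaban1982Higgs1, (3.27)–(3.28) p.617] -/
theorem chiW_mem_Icc (C : ChargeData N) (ℓ p : ℕ → ℝ) (mu0sq msq a : ℝ) :
    ∀ (k : ℕ) (A : VecField P k) (φ : ScalarField P k N), chiW C ℓ p mu0sq msq a k A φ ∈ Set.Icc (0 : ℝ) 1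
  | 0, A, φ => chi0_mem_Icc C (ℓ 0) (p 0) A φ
  | k + 1, A, φ => chiK_mem_Icc C (ℓ (k + 1)) (p (k + 1)) mu0sq msq a (k + 1) A φ

/-- The weight `(A, φ) ↦ χ_k(A)χ_k(φ)` is jointly measurable at every level (`k = 0`: `B1Eq31Concrete.measurable_chi0`; `k ≧ 1`:
`HiggsCovarianceCont.measurable_chiK`, which needs `m² > 0` and `a_k ≧ 0`, i.e. `a ≧ 0`). [cite: Balaban1982Higgs1, (3.27)–(3.28) p.617] -/
theorem measurable_chiW (C : ChargeData N) (ℓ p : ℕ → ℝ) (mu0sq : ℝ) {msq a : ℝ} (hmsq : 0 < msq) (ha : 0 ≤ a) :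
    ∀ k : ℕ, Measurable fun q : VecField P k × ScalarField P k N => chiW C ℓ p mu0sq msq a k q.1 q.2
  | 0 => measurable_chi0 C (ℓ 0) (p 0)
  | k + 1 => measurable_chiK C (ℓ (k + 1)) (p (k + 1)) mu0sq hmsq a (k + 1) (aSeq_nonneg (P := P) ha (k + 1))

/-- The external-field assignment `A ↦ Ã_k(A)` is measurable at every level (identity, resp. the linear map (3.29)).
[cite: Balaban1982Higgs1, (3.29) p.617] -/
theorem measurable_extW (mu0sq a : ℝ) : ∀ k : ℕ, Measurable (extW (P := P) mu0sq a k)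
  | 0 => measurable_id
  | k + 1 => measurable_bgVec mu0sq a (k + 1)

/-- The `k`-th cut-off density `χ_k(A)χ_k(φ)exp(−S^{(k),L^kε}(A,φ))` of (3.26) is non-negative. [cite: Balaban1982Higgs1, (3.26) p.617] -/
theorem density_nonneg (C : ChargeData N) (ℓ p : ℕ → ℝ) (mu0sq msq a : ℝ) (k : ℕ)
    (S : VecField P k → ScalarField P k N → ℝ) (A : VecField P k) (φ : ScalarField P k N) :
    0 ≤ chiW C ℓ p mu0sq msq a k A φ * Real.exp (-S A φ) :=
  mul_nonneg (chiW_mem_Icc C ℓ p mu0sq msq a k A φ).1 (Real.exp_pos _).le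

/-- The `k`-th cut-off density is integrable (`dA dφ`) as soon as `exp(−S^{(k),L^kε})` is (`m² > 0`, `a ≧ 0`).
[cite: Balaban1982Higgs1, (3.26) p.617] -/
theorem integrable_density (C : ChargeData N) (ℓ p : ℕ → ℝ) (mu0sq : ℝ) {msq a : ℝ} (hmsq : 0 < msq) (ha : 0 ≤ a)
    (k : ℕ) {S : VecField P k → ScalarField P k N → ℝ}
    (hS : Integrable fun Φ : VecField P k × ScalarField P k N => Real.exp (-S Φ.1 Φ.2)) :
    Integrable fun Φ : VecField P k × ScalarField P k N => chiW C ℓ p mu0sq msq a k Φ.1 Φ.2 * Real.exp (-S Φ.1 Φ.2) := by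
  refine hS.bdd_mul (c := 1) (measurable_chiW C ℓ p mu0sq hmsq ha k).aestronglyMeasurable
    (Filter.Eventually.of_forall fun Φ => ?_)
  rw [Real.norm_of_nonneg (chiW_mem_Icc C ℓ p mu0sq msq a k Φ.1 Φ.2).1]
  exact (chiW_mem_Icc C ℓ p mu0sq msq a k Φ.1 Φ.2).2

end Weights

/-! ## 2. The run of the model: r14's carrier `B1LowerBound.Run326` inhabited -/

section Run

/-- **THE RUN OF THE (Higgs)₂,₃ MODEL** at the lattice datum `P` (spacing `ε`, block size `L`), `K` steps, actions
`S^{(k),L^kε} = S k`: r14's `Run326` with `eps = ε`, `L = L`, `vol = |T_ε| = Σ_{x∈T_ε} ε^d` (1.21), `Z = ∫dA∫dφ exp(−S^{(0)})`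
(`= Z^ε` (1.10) for `S 0 = S^ε`, `run326_Z_printed`) and `intK k = ∫dA∫dφ χ_k(A)χ_k(φ)exp(−S^{(k),L^kε}(A,φ))`, the `k`-th
cut-off integral of (3.26) with the printed characteristic functions (`chiW`). [cite: Balaban1982Higgs1, (3.26) p.617] -/
noncomputable def run326 (P : Params) (N : ℕ) (C : ChargeData N) (ℓ p : ℕ → ℝ) (mu0sq msq a : ℝ) (K : ℕ)
    (S : (k : ℕ) → VecField P k → ScalarField P k N → ℝ) : Run326 where
  eps := P.ε
  L := P.L
  K := K
  vol := P.vol 0 Finset.univ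
  Z := ∫ Φ : VecField P 0 × ScalarField P 0 N, Real.exp (-S 0 Φ.1 Φ.2)
  intK := fun k => ∫ Φ : VecField P k × ScalarField P k N, chiW C ℓ p mu0sq msq a k Φ.1 Φ.2 * Real.exp (-S k Φ.1 Φ.2)

variable (C : ChargeData N) (ℓ p : ℕ → ℝ) (mu0sq msq a : ℝ) (K : ℕ) (S : (k : ℕ) → VecField P k → ScalarField P k N → ℝ)

/-- The scales of the run are the meshes of the lattice family: `L^k · eps = L^kε = P.mesh k` ((1.19) p. 607).
[cite: Balaban1982Higgs1, (1.19) p.607] -/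
theorem run326_scale (k : ℕ) : (run326 P N C ℓ p mu0sq msq a K S).L ^ k * (run326 P N C ℓ p mu0sq msq a K S).eps = P.mesh k :=
  rfl

/-- The volume field of the run is `|T_ε| = Σ_{x∈T_ε} ε^d` (1.21). [cite: Balaban1982Higgs1, (1.21) p.607] -/
theorem run326_vol : (run326 P N C ℓ p mu0sq msq a K S).vol = P.vol 0 Finset.univ := rfl

/-- The `k`-th cut-off integral of the run, unfolded. [cite: Balaban1982Higgs1, (3.26) p.617] -/
theorem run326_intK (k : ℕ) :
    (run326 P N C ℓ p mu0sq msq a K S).intK k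
      = ∫ Φ : VecField P k × ScalarField P k N, chiW C ℓ p mu0sq msq a k Φ.1 Φ.2 * Real.exp (-S k Φ.1 Φ.2) :=
  rfl

/-- The run's `Z`, unfolded: `∫dA∫dφ exp(−S^{(0)}(A,φ))`. [cite: Balaban1982Higgs1, (1.10) p.605] -/
theorem run326_Z :
    (run326 P N C ℓ p mu0sq msq a K S).Z = ∫ Φ : VecField P 0 × ScalarField P 0 N, Real.exp (-S 0 Φ.1 Φ.2) :=
  rfl

/-- With `S 0 = S^ε` (the action (1.11), `HiggsLattice.action C c`) the run's `Z` IS the partition function `Z^ε` (1.10).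
[cite: Balaban1982Higgs1, (1.10) p.605] -/
theorem run326_Z_printed (c : Couplings) (h0 : S 0 = action C c) :
    (run326 P N C ℓ p mu0sq msq a K S).Z = partitionFn P 0 N C c := by
  rw [partitionFn_eq, run326_Z, h0]

end Run

/-! ## 3. The base case `k = 0` -/

section Base

variable (C : ChargeData N) (ℓ p : ℕ → ℝ) (mu0sq msq a : ℝ) (K : ℕ)

/-- **(3.26) at `k = 0` for the model**: `∫dA∫dφ χ₀(A)χ₀(φ)exp(−S^{(0)}) ≦ ∫dA∫dφ exp(−S^{(0)})` — inserting
`0 ≦ χ₀(A)χ₀(φ) ≦ 1` (this seat's schematic `B1IndHyp326Proof.base326` on the concrete configuration space; for `S 0 = S^ε`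
it is the typer's `B1Ineq36Printed.base326_printed`). [cite: Balaban1982Higgs1, (3.26) p.617; (3.1)–(3.2) p.613] -/
theorem base326_model (S : (k : ℕ) → VecField P k → ScalarField P k N → ℝ)
    (hS0 : Integrable fun Φ : VecField P 0 × ScalarField P 0 N => Real.exp (-S 0 Φ.1 Φ.2)) :
    (run326 P N C ℓ p mu0sq msq a K S).intK 0 ≤ (run326 P N C ℓ p mu0sq msq a K S).Z :=
  B1IndHyp326Proof.base326 (volume : Measure (VecField P 0 × ScalarField P 0 N)) hS0 (fun _ => (Real.exp_pos _).le)
    (fun Φ => (chiW_mem_Icc C ℓ p mu0sq msq a 0 Φ.1 Φ.2).1) (fun Φ => (chiW_mem_Icc C ℓ p mu0sq msq a 0 Φ.1 Φ.2).2)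

end Base

/-! ## 4. The one-step inequality from (2.9)/(3.37) and the printed lower bound of the inner integral -/

section Step

variable (C : ChargeData N) (ℓ p : ℕ → ℝ) (mu0sq : ℝ) {msq a : ℝ}

/-- **The integral inequality of (3.6) p. 613 / inside (3.37) p. 618, for the model, at every level `k`**:
`∫dB∫dψ χ_{k+1}(B)χ_{k+1}(ψ) T^{L^kε}_{a,L}[T^{L^kε}_{a,L,Ã_k}[χ_k(A)χ_k(φ)exp(−S^{(k),L^kε})]] ≦ ∫dA∫dφ χ_k(A)χ_k(φ)exp(−S^{(k),L^kε})`
(`a > 0`, `m² > 0`, `exp(−S^{(k)}) ∈ L¹`) — (2.9) for the double transformation and the insertion of `χ_{k+1} ≦ 1`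
(`HiggsDoubleRT.integral_cutoff_doubleRTk_le`); at `k = 0` the external field is `A` ((3.6)), at `k ≧ 1` it is `A^{(k),ε}`
((3.37): the typer's `B1Ineq337HiggsModel.lowerStep337`). [cite: Balaban1982Higgs1, (3.37) p.618; (3.6) p.613; (2.9) p.609] -/
theorem lowerStep_model (ha : 0 < a) (hmsq : 0 < msq) (k : ℕ) {Sk : VecField P k → ScalarField P k N → ℝ}
    (hSk : Integrable fun Φ : VecField P k × ScalarField P k N => Real.exp (-Sk Φ.1 Φ.2)) :
    ∫ Ψ : VecField P (k + 1) × ScalarField P (k + 1) N,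
        chiW C ℓ p mu0sq msq a (k + 1) Ψ.1 Ψ.2
          * doubleRTk C a (extW mu0sq a k) (fun A φ => chiW C ℓ p mu0sq msq a k A φ * Real.exp (-Sk A φ)) Ψ.1 Ψ.2
      ≤ ∫ Φ : VecField P k × ScalarField P k N, chiW C ℓ p mu0sq msq a k Φ.1 Φ.2 * Real.exp (-Sk Φ.1 Φ.2) :=
  integral_cutoff_doubleRTk_le ha C (measurable_extW mu0sq a k) (integrable_density C ℓ p mu0sq hmsq ha.le k hSk)
    (density_nonneg C ℓ p mu0sq msq a k Sk) (χ' := fun B ψ => chiW C ℓ p mu0sq msq a (k + 1) B ψ)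
    fun B ψ => chiW_mem_Icc C ℓ p mu0sq msq a (k + 1) B ψ

/-- **THE ONE-STEP INEQUALITY for the model** (the hypothesis `hstep` of `B1IndHyp326Proof.ineq326_of_step`, PROVED for the
run of the model modulo the printed lower bound of the inner integral): if on the support of `χ_{k+1}(B)χ_{k+1}(ψ)`
`exp(−S^{(k+1),L^{k+1}ε}(B,ψ))·exp(−C(L^kε)^{κ₀}|T_ε|) ≦ T^{L^kε}_{a,L}[T^{L^kε}_{a,L,Ã_k}[χ_kχ_k exp(−S^{(k),L^kε})]](B,ψ)`
((3.38), (3.51), (3.55), (3.60) rescaled back to the `L^{k+1}ε`-lattice, p. 623; `h360`), then `intK(k+1)·exp(−C(L^kε)^{κ₀}|T_ε|)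
≦ intK k`: multiply by `χ_{k+1}χ_{k+1} ≧ 0`, integrate (`HiggsDoubleRT.integrable_doubleRTk`), apply `lowerStep_model`.
[cite: Balaban1982Higgs1, (3.60) p.623; (3.37) p.618; (3.26) p.617] -/
theorem step326_model (ha : 0 < a) (hmsq : 0 < msq) (K : ℕ) (S : (k : ℕ) → VecField P k → ScalarField P k N → ℝ) (k : ℕ)
    (hSk : Integrable fun Φ : VecField P k × ScalarField P k N => Real.exp (-S k Φ.1 Φ.2)) {Cst κ₀ : ℝ}
    (h360 : ∀ (B : VecField P (k + 1)) (ψ : ScalarField P (k + 1) N), chiW C ℓ p mu0sq msq a (k + 1) B ψ ≠ 0 →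
      Real.exp (-S (k + 1) B ψ) * Real.exp (-(Cst * P.mesh k ^ κ₀ * P.vol 0 Finset.univ))
        ≤ doubleRTk C a (extW mu0sq a k) (fun A φ => chiW C ℓ p mu0sq msq a k A φ * Real.exp (-S k A φ)) B ψ) :
    (run326 P N C ℓ p mu0sq msq a K S).intK (k + 1)
        * Real.exp (-(Cst * ((run326 P N C ℓ p mu0sq msq a K S).L ^ k * (run326 P N C ℓ p mu0sq msq a K S).eps) ^ κ₀
            * (run326 P N C ℓ p mu0sq msq a K S).vol))
      ≤ (run326 P N C ℓ p mu0sq msq a K S).intK k := by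
  rw [run326_scale, run326_vol, run326_intK, run326_intK, ← integral_mul_const]
  refine le_trans ?_ (lowerStep_model C ℓ p mu0sq ha hmsq k hSk)
  have hρ := integrable_density C ℓ p mu0sq hmsq ha.le k hSk
  have hT := integrable_doubleRTk ha C (measurable_extW mu0sq a k)
    (ρ := fun A φ => chiW C ℓ p mu0sq msq a k A φ * Real.exp (-S k A φ)) hρ
  have hint : Integrable fun Ψ : VecField P (k + 1) × ScalarField P (k + 1) N =>
      chiW C ℓ p mu0sq msq a (k + 1) Ψ.1 Ψ.2
        * doubleRTk C a (extW mu0sq a k) (fun A φ => chiW C ℓ p mu0sq msq a k A φ * Real.exp (-S k A φ)) Ψ.1 Ψ.2 := by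
    refine hT.bdd_mul (c := 1) (measurable_chiW C ℓ p mu0sq hmsq ha.le (k + 1)).aestronglyMeasurable
      (Filter.Eventually.of_forall fun Ψ => ?_)
    rw [Real.norm_of_nonneg (chiW_mem_Icc C ℓ p mu0sq msq a (k + 1) Ψ.1 Ψ.2).1]
    exact (chiW_mem_Icc C ℓ p mu0sq msq a (k + 1) Ψ.1 Ψ.2).2
  refine integral_mono_of_nonneg (Filter.Eventually.of_forall fun Ψ =>
    mul_nonneg (density_nonneg C ℓ p mu0sq msq a (k + 1) (S (k + 1)) Ψ.1 Ψ.2) (Real.exp_pos _).le) hint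
    (Filter.Eventually.of_forall fun Ψ => ?_)
  by_cases h0 : chiW C ℓ p mu0sq msq a (k + 1) Ψ.1 Ψ.2 = 0
  · simp only [h0, zero_mul, le_refl]
  · calc chiW C ℓ p mu0sq msq a (k + 1) Ψ.1 Ψ.2 * Real.exp (-S (k + 1) Ψ.1 Ψ.2)
          * Real.exp (-(Cst * P.mesh k ^ κ₀ * P.vol 0 Finset.univ))
        = chiW C ℓ p mu0sq msq a (k + 1) Ψ.1 Ψ.2
            * (Real.exp (-S (k + 1) Ψ.1 Ψ.2) * Real.exp (-(Cst * P.mesh k ^ κ₀ * P.vol 0 Finset.univ))) := by ring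
      _ ≤ chiW C ℓ p mu0sq msq a (k + 1) Ψ.1 Ψ.2
            * doubleRTk C a (extW mu0sq a k) (fun A φ => chiW C ℓ p mu0sq msq a k A φ * Real.exp (-S k A φ)) Ψ.1 Ψ.2 :=
          mul_le_mul_of_nonneg_left (h360 Ψ.1 Ψ.2 h0) (chiW_mem_Icc C ℓ p mu0sq msq a (k + 1) Ψ.1 Ψ.2).1

end Step

/-! ## 5. (3.26) for the model, for every `k ≦ K`; the induction hypothesis of record for a family of spacings -/

section Induction

variable (C : ChargeData N) (ℓ p : ℕ → ℝ) (mu0sq : ℝ) {msq a : ℝ}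

/-- **(3.26) p. 617 FOR THE (Higgs)₂,₃ MODEL, every `k ≦ K`**: for `a > 0`, `m² > 0`, any `μ₀²`, thresholds, actions
`S^{(k),L^kε}` (`k ≦ K`) with `exp(−S^{(k)}) ∈ L¹(dA dφ)`, and `C`, `κ₀` for which the printed lower bound of the inner integral
of (3.37) holds at every level `k < K` (`h360`, pp. 619–623): `(∫dA∫dφ χ_k(A)χ_k(φ)exp(−S^{(k),L^kε}))·exp(−CΣ_{j<k}(L^jε)^{κ₀}|T_ε|)
≦ ∫dA∫dφ exp(−S^{(0)})` — the induction on `k` (`B1IndHyp326Proof.ineq326_of_step`) with base `base326_model` and step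
`step326_model` for the run of the model. [cite: Balaban1982Higgs1, (3.26) p.617; (3.60) p.623] -/
theorem ineq326_model (ha : 0 < a) (hmsq : 0 < msq) (K : ℕ) (S : (k : ℕ) → VecField P k → ScalarField P k N → ℝ)
    (hS : ∀ k, k ≤ K → Integrable fun Φ : VecField P k × ScalarField P k N => Real.exp (-S k Φ.1 Φ.2)) {Cst κ₀ : ℝ}
    (h360 : ∀ k, k < K → ∀ (B : VecField P (k + 1)) (ψ : ScalarField P (k + 1) N),
      chiW C ℓ p mu0sq msq a (k + 1) B ψ ≠ 0 →
        Real.exp (-S (k + 1) B ψ) * Real.exp (-(Cst * P.mesh k ^ κ₀ * P.vol 0 Finset.univ))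
          ≤ doubleRTk C a (extW mu0sq a k) (fun A φ => chiW C ℓ p mu0sq msq a k A φ * Real.exp (-S k A φ)) B ψ) :
    ∀ k, k ≤ K →
      (∫ Φ : VecField P k × ScalarField P k N, chiW C ℓ p mu0sq msq a k Φ.1 Φ.2 * Real.exp (-S k Φ.1 Φ.2))
          * Real.exp (-(Cst * (∑ j ∈ range k, P.mesh j ^ κ₀) * P.vol 0 Finset.univ))
        ≤ ∫ Φ : VecField P 0 × ScalarField P 0 N, Real.exp (-S 0 Φ.1 Φ.2) := by
  intro k hk
  have h := ineq326_of_step (run326 P N C ℓ p mu0sq msq a K S) (C := Cst) (κ₀ := κ₀)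
    (base326_model C ℓ p mu0sq msq a K S (hS 0 (Nat.zero_le K)))
    (fun j hj => step326_model C ℓ p mu0sq ha hmsq K S j (hS j hj.le) (h360 j hj)) k hk
  simpa only [run326_scale, run326_vol, run326_intK, run326_Z] using h

/-- **(3.26) for the model with the printed right side `Z^ε`**: when `S^{(0)} = S^ε` is the action (1.11) (`HiggsLattice.action
C c`, `μ₀² > 0`, `λ > 0` for `exp(−S^ε) ∈ L¹`), the conclusion of `ineq326_model` reads `(∫dA∫dφ χ_kχ_k exp(−S^{(k),L^kε}))
·exp(−CΣ_{j<k}(L^jε)^{κ₀}|T_ε|) ≦ Z^ε = HiggsLattice.partitionFn P 0 N C c`. [cite: Balaban1982Higgs1, (3.26) p.617; (1.10) p.605] -/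
theorem ineq326_model_printed (ha : 0 < a) (hmsq : 0 < msq) (c : Couplings) (hmu : 0 < c.mu0sq) (hlam : 0 < c.lam)
    (K : ℕ) (S : (k : ℕ) → VecField P k → ScalarField P k N → ℝ) (h0 : S 0 = action C c)
    (hS : ∀ k, 1 ≤ k → k ≤ K → Integrable fun Φ : VecField P k × ScalarField P k N => Real.exp (-S k Φ.1 Φ.2))
    {Cst κ₀ : ℝ}
    (h360 : ∀ k, k < K → ∀ (B : VecField P (k + 1)) (ψ : ScalarField P (k + 1) N),
      chiW C ℓ p mu0sq msq a (k + 1) B ψ ≠ 0 →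
        Real.exp (-S (k + 1) B ψ) * Real.exp (-(Cst * P.mesh k ^ κ₀ * P.vol 0 Finset.univ))
          ≤ doubleRTk C a (extW mu0sq a k) (fun A φ => chiW C ℓ p mu0sq msq a k A φ * Real.exp (-S k A φ)) B ψ) :
    ∀ k, k ≤ K →
      (∫ Φ : VecField P k × ScalarField P k N, chiW C ℓ p mu0sq msq a k Φ.1 Φ.2 * Real.exp (-S k Φ.1 Φ.2))
          * Real.exp (-(Cst * (∑ j ∈ range k, P.mesh j ^ κ₀) * P.vol 0 Finset.univ))
        ≤ partitionFn P 0 N C c := by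
  have hS' : ∀ k, k ≤ K → Integrable fun Φ : VecField P k × ScalarField P k N => Real.exp (-S k Φ.1 Φ.2) := by
    intro k hk
    rcases Nat.eq_zero_or_pos k with rfl | hpos
    · rw [h0]
      exact integrable_exp_neg_action C c hmu hlam
    · exact hS k hpos hk
  intro k hk
  have h := ineq326_model C ℓ p mu0sq ha hmsq K S hS' h360 k hk
  rw [partitionFn_eq, ← h0]
  exact h

/-- **The induction hypothesis of record `B1LowerBound.IndHyp326` FOR THE MODEL along a family of lattice data** (all spacings
`ε`; index `i`: lattice datum `P i`, steps `K i`, actions `S i k`; common charge data, masses, `a`, thresholds): if ONE pair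
`C`, `κ₀ > 0` serves the printed lower bound of the inner integral at every spacing and level (*"O(1) in (3.26) is independent of
k, and κ₀ > 0"*, p. 617), then `IndHyp326` holds for the family of runs. [cite: Balaban1982Higgs1, (3.26) p.617; (3.60) p.623] -/
theorem indHyp326_model {I : Type} (Pf : I → Params) (ha : 0 < a) (hmsq : 0 < msq) (Kf : I → ℕ)
    (Sf : (i : I) → (k : ℕ) → VecField (Pf i) k → ScalarField (Pf i) k N → ℝ)
    (hS : ∀ i k, k ≤ Kf i → Integrable fun Φ : VecField (Pf i) k × ScalarField (Pf i) k N => Real.exp (-Sf i k Φ.1 Φ.2))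
    {Cst κ₀ : ℝ} (hκ₀ : 0 < κ₀)
    (h360 : ∀ i k, k < Kf i → ∀ (B : VecField (Pf i) (k + 1)) (ψ : ScalarField (Pf i) (k + 1) N),
      chiW C ℓ p mu0sq msq a (k + 1) B ψ ≠ 0 →
        Real.exp (-Sf i (k + 1) B ψ) * Real.exp (-(Cst * (Pf i).mesh k ^ κ₀ * (Pf i).vol 0 Finset.univ))
          ≤ doubleRTk C a (extW mu0sq a k) (fun A φ => chiW C ℓ p mu0sq msq a k A φ * Real.exp (-Sf i k A φ)) B ψ) :
    IndHyp326 fun i => run326 (Pf i) N C ℓ p mu0sq msq a (Kf i) (Sf i) :=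
  indHyp326_of_step (fun i => run326 (Pf i) N C ℓ p mu0sq msq a (Kf i) (Sf i)) hκ₀
    (fun i => base326_model C ℓ p mu0sq msq a (Kf i) (Sf i) (hS i 0 (Nat.zero_le _)))
    (fun i j hj => step326_model C ℓ p mu0sq ha hmsq (Kf i) (Sf i) j (hS i j hj.le) (h360 i j hj))

end Induction

/-! ## 6. (3.26) at `k = K` ⇒ (3.67) p. 625, for the model -/

section LastStep

variable (C : ChargeData N) (ℓ p : ℕ → ℝ) (mu0sq : ℝ) {msq a : ℝ}

/-- **(3.67) p. 625 for the model**, ONE explicit `O(1)` multiplying `|T_ε|`: the schematic `B1Ineq367Proof.ineq367_O1` on the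
concrete level-`K` configuration space of `T^{(K)}_{L^Kε}` (Lebesgue measure), `χ_K` THE MODEL'S `χ_K(A)χ_K(φ)`, its hypothesis
(3.26)_K DISCHARGED by `ineq326_model`; the expansion inputs of pp. 624–625 stay displayed as there: (E1) `Z_KZ_K(0)·exp(−½qA −
½qφ0 + V − E₀ − C₁|T_ε|) ≦ exp(−S^{(K)})` on the support of `χ_K` (Prop. 3.1, (3.30)–(3.32), (3.46)–(3.47)), (E2) `|V^{(K)}| ≦
C₂|T_ε|` there (Prop. 3.2), (E3) `χsm ≦ χ_K` (`B1Ineq367Proof.chiK_of_small`); stopping rule `L^Kε ≦ ε₀` (p. 624).  Conclusion: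
`(∫ χsm·Z_KZ_K(0)·exp(−½qA − ½qφ0 − E₀))·exp(−(C₁ + C₂ + C·ε₀^{κ₀}/(L^{κ₀} − 1))|T_ε|) ≦ ∫dA∫dφ exp(−S^{(0)})`.
[cite: Balaban1982Higgs1, (3.67) p.625; (3.26) p.617] -/
theorem ineq367_model (ha : 0 < a) (hmsq : 0 < msq) (hL : 1 < (P.L : ℝ)) (K : ℕ)
    (S : (k : ℕ) → VecField P k → ScalarField P k N → ℝ)
    (hS : ∀ k, k ≤ K → Integrable fun Φ : VecField P k × ScalarField P k N => Real.exp (-S k Φ.1 Φ.2))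
    {Cst κ₀ ε₀ : ℝ} (hC : 0 ≤ Cst) (hκ₀ : 0 < κ₀) (hK : P.mesh K ≤ ε₀)
    (h360 : ∀ k, k < K → ∀ (B : VecField P (k + 1)) (ψ : ScalarField P (k + 1) N),
      chiW C ℓ p mu0sq msq a (k + 1) B ψ ≠ 0 →
        Real.exp (-S (k + 1) B ψ) * Real.exp (-(Cst * P.mesh k ^ κ₀ * P.vol 0 Finset.univ))
          ≤ doubleRTk C a (extW mu0sq a k) (fun A φ => chiW C ℓ p mu0sq msq a k A φ * Real.exp (-S k A φ)) B ψ)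
    {qA qφ0 V χsm : VecField P K × ScalarField P K N → ℝ} {ZK E₀ C₁ C₂ : ℝ} (hZK : 0 ≤ ZK)
    (hE1 : ∀ ω : VecField P K × ScalarField P K N, chiW C ℓ p mu0sq msq a K ω.1 ω.2 ≠ 0 →
      ZK * Real.exp (-(qA ω) / 2 - qφ0 ω / 2 + V ω - E₀ - C₁ * P.vol 0 Finset.univ) ≤ Real.exp (-S K ω.1 ω.2))
    (hE2 : ∀ ω : VecField P K × ScalarField P K N, chiW C ℓ p mu0sq msq a K ω.1 ω.2 ≠ 0 →
      |V ω| ≤ C₂ * P.vol 0 Finset.univ)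
    (hχsm0 : ∀ ω, 0 ≤ χsm ω) (hE3 : ∀ ω, χsm ω ≤ chiW C ℓ p mu0sq msq a K ω.1 ω.2) :
    (∫ ω : VecField P K × ScalarField P K N, χsm ω * (ZK * Real.exp (-(qA ω) / 2 - qφ0 ω / 2 - E₀)))
        * Real.exp (-((C₁ + C₂ + Cst * (ε₀ ^ κ₀ / ((P.L : ℝ) ^ κ₀ - 1))) * P.vol 0 Finset.univ))
      ≤ ∫ Φ : VecField P 0 × ScalarField P 0 N, Real.exp (-S 0 Φ.1 Φ.2) := by
  have h326 := ineq326_model C ℓ p mu0sq ha hmsq K S hS h360 K le_rfl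
  have hvol : 0 ≤ P.vol 0 Finset.univ := by
    unfold Params.vol
    exact mul_nonneg (pow_nonneg (P.mesh_pos 0).le _) (Nat.cast_nonneg _)
  have hmesh : ∀ j : ℕ, P.mesh j = (P.L : ℝ) ^ j * P.ε := fun j => rfl
  simp only [hmesh] at h326 hK
  exact B1Ineq367Proof.ineq367_O1 (volume : Measure (VecField P K × ScalarField P K N))
    (S := fun ω => S K ω.1 ω.2) (χK := fun ω => chiW C ℓ p mu0sq msq a K ω.1 ω.2) hZK hC hvol hL P.hε hκ₀ hK h326
    (fun ω => chiW_mem_Icc C ℓ p mu0sq msq a K ω.1 ω.2) (integrable_density C ℓ p mu0sq hmsq ha.le K (hS K le_rfl))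
    hE1 hE2 hχsm0 hE3

end LastStep

end Literature.MathematicalPhysics.QuantumFieldTheory.Balaban1983to89.B1Ineq326HiggsModel
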